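import Literature.NumberTheory.EllipticCurves.MazurTorsionThirdReductionProofs
import Literature.NumberTheory.EllipticCurves.MazurTorsionHerbrandProofs
import Literature.NumberTheory.EllipticCurves.X1ElevenMordellWeil
import HarnessLib

/-!
# Mazur 1977, Ch. III §5: the prime-case leaf from Step 3 alone; Mazur's theorem for every
# elliptic curve over `ℚ` without bad primes `q ≡ ±1 (mod N)` / with bad primes `≤ 17`

Sibling proof file (theorems only; no definition, no named fact) of
`MazurTorsionThirdReductionProofs` and `MazurTorsionHerbrandProofs` for the prime-case leaf
`Literature.NumberTheory.EllipticCurves.Mazur1977_no_prime_torsion W` (B. Mazur, *Modular curves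
and the Eisenstein ideal*, Publ. Math. IHÉS 47 (1977), Ch. III §5, pp. 156–160).  With the input
(R3) of the Third reduction (Herbrand's theorem at `B₂` with class field theory) now proved
(`Mazur1977_herbrand`), the consequences for the leaf:

* `Mazur1977_no_prime_torsion_of_stepThree` — **the leaf follows from Step 3 alone**: the only
  printed input of pp. 156–160 not formalised in the tree is Mazur's Step 3 at the bad primes
  `q ≠ N` with `N ≤ q + 1` ("`ℤ/N ⊄ (E_{/𝔽_q})⁰`", p. 159, via `X₀(N)_{/ℤ[1/2N]}`, the cusps
  `0, ∞` and the Eisenstein quotient `J̃` with `J̃(ℚ)` finite, Thm. III.(3.1));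
* `Mazur1977_not_exists_addOrderOf_eq` — unconditionally, **no elliptic curve over `ℚ` whose bad
  primes `q ≠ N` satisfy `q + 1 < N` has a rational point of prime order `N ∉ {2, 3, 5, 7, 13}`**;
* `Mazur1977_not_mem_goodReductionSubgroup_of_not_dvd`, `Mazur1977_not_exists_addOrderOf_eq_of_not_dvd`
  — the same with the sharper local condition: Step 3 holds without modular curves at every bad
  prime `q ≢ ±1 (mod N)` (a point of order `N` on the identity component of a multiplicative fibre
  forces `N ∣ #Ẽ_ns(𝔽_q) ∣ q² - 1`), so **no elliptic curve over `ℚ` without bad primes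
  `q ≡ ±1 (mod N)` has a rational point of prime order `N ∉ {2, 3, 5, 7, 13}`** — Mazur's global
  Step 3 (Eisenstein quotient) is needed exactly at the bad primes `q ≡ ±1 (mod N)`;
* `Mazur1977_no_prime_torsion_of_bad_primes_le_seventeen` — unconditionally, **Mazur's theorem
  (prime case) for every elliptic curve over `ℚ` with good reduction outside the primes `≤ 17`**
  (`N = 11` by the tree's Billing–Mahler file `X1ElevenMordellWeil`).

## References

* B. Mazur, *Modular curves and the Eisenstein ideal*, Publ. Math. IHÉS 47 (1977) 33–186,
  Ch. III §5, pp. 156–160. [Mazur1977]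
-/

noncomputable section

open scoped NumberField Pointwise Classical
open Field IsDedekindDomain NumberField

namespace Literature.NumberTheory.EllipticCurves

open Literature.NumberTheory.GaloisRepresentations

/-! ### The prime-case leaf from Step 3 alone; unconditional cases -/

section Leaf

open _root_.WeierstrassCurve Rat.HeightOneSpectrum

variable (W : WeierstrassCurve ℚ) [W.IsElliptic]

omit [W.IsElliptic] in
/-- **Mazur's prime-case leaf from Step 3 alone.**  With (R3) discharged (`Mazur1977_herbrand`),
the tree's `Mazur1977_no_prime_torsion_of_stepThree_of_herbrand` reduces
`Mazur1977_no_prime_torsion W` to the single remaining printed input (S3): Mazur's Step 3 at the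
bad primes `q` of the putative curve with `N ≤ q + 1`, `q ≠ N` ("`ℤ/N ⊄ (E_{/𝔽_q})⁰`", Mazur 1977
III.§5 p. 159, proved there through `X₀(N)_{/ℤ[1/2N]}`, the cusps `0, ∞` and the Eisenstein quotient
`J̃` with `J̃(ℚ)` finite, Thm. III.(3.1)) — everything else of pp. 156–160 (First and Second
reductions, (5.4), Steps 1, 2, Step 3 for `q + 1 < N` and at `q = N`, Step 4, the Third reduction
and now Herbrand with class field theory) being formalised in this file and its siblings.
[cite: Mazur1977, Ch. III §5, pp. 156–160] -/
theorem Mazur1977_no_prime_torsion_of_stepThree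
    (hS3 : ∀ (E : WeierstrassCurve ℚ) [E.IsElliptic] (N : ℕ) [Fact N.Prime],
      N ∉ ({2, 3, 5, 7, 13} : Finset ℕ) → ∀ {P : E.toAffine.Point}, addOrderOf P = N →
        ∀ v : HeightOneSpectrum (𝓞 ℚ), ¬ E.HasGoodReductionAt v → (primesEquiv v : ℕ) ≠ N →
          N ≤ (primesEquiv v : ℕ) + 1 →
            VariableChange.pointEquiv (E.baseChange (v.adicCompletion ℚ))
                ((E.baseChange (v.adicCompletion ℚ)).exists_isMinimal
                  (v.adicCompletionIntegers ℚ)).choose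
                (Affine.Point.map (W' := E.toAffine) (S := ℚ)
                  (Algebra.ofId ℚ (v.adicCompletion ℚ)) P) ∉
              (E.localMinimalModel v).goodReductionSubgroup (v.adicCompletionIntegers ℚ)) :
    Mazur1977_no_prime_torsion W :=
  Mazur1977_no_prime_torsion_of_stepThree_of_herbrand W hS3 fun _ _ hNS =>
    Mazur1977_herbrand (List.ne_of_not_mem_cons hNS)

/-- **Mazur's theorem (prime case) for the curves whose bad primes `q ≠ N` satisfy `q + 1 < N`,
unconditionally.**  For a prime `N ∉ {2, 3, 5, 7, 13}` and an elliptic curve `W/ℚ` every bad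
prime `q` of which has `q + 1 < N` or `q = N`, no point of `W(ℚ)` has order `N`: the tree's
`Mazur1977_not_exists_addOrderOf_eq_of_herbrand` (Second and Third reductions, Steps 1–4, Step 3
in the range `q + 1 < N` by counting points on the Néron component group) with (R3) supplied by
`Mazur1977_herbrand`. [cite: Mazur1977, Ch. III §5, pp. 156–160] -/
theorem Mazur1977_not_exists_addOrderOf_eq {N : ℕ} [Fact N.Prime]
    (hNS : N ∉ ({2, 3, 5, 7, 13} : Finset ℕ))
    (hbad : ∀ v : HeightOneSpectrum (𝓞 ℚ), ¬ W.HasGoodReductionAt v →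
      (primesEquiv v : ℕ) + 1 < N ∨ (primesEquiv v : ℕ) = N) :
    ¬ ∃ P : W.toAffine.Point, addOrderOf P = N :=
  Mazur1977_not_exists_addOrderOf_eq_of_herbrand W hNS
    (Mazur1977_herbrand (List.ne_of_not_mem_cons hNS)) hbad

/-- `N` is a unit in the residue field of `𝓞_{ℚ,v}` when the prime under `v` is not `N`. [folklore] -/
theorem natCast_residueField_adicCompletionIntegers_ne_zero (v : HeightOneSpectrum (𝓞 ℚ)) {N : ℕ}
    (hN : N.Prime) (hvN : (primesEquiv v : ℕ) ≠ N) :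
    (N : IsLocalRing.ResidueField (v.adicCompletionIntegers ℚ)) ≠ 0 := by
  intro h
  have h' : IsLocalRing.residue (v.adicCompletionIntegers ℚ)
      (algebraMap (𝓞 ℚ) (v.adicCompletionIntegers ℚ) (N : 𝓞 ℚ)) = 0 := by
    rwa [map_natCast, map_natCast]
  have hmem := (HeightOneSpectrum.residue_algebraMap_eq_zero_iff ℚ v (N : 𝓞 ℚ)).mp h'
  rw [Rat.natCast_mem_asIdeal_iff] at hmem
  exact hvN ((Nat.prime_dvd_prime_iff_eq (primesEquiv v).2 hN).mp hmem)

/-- **Mazur's "`ℤ/N ⊄ (E_{/𝔽_q})⁰`" without modular curves at every bad prime `q ≢ ±1 (mod N)`.**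
Let `E/ℚ` be an elliptic curve, `N ∉ {2, 3, 5, 7, 13}` a prime, `v` a place of bad reduction whose
prime `q ≠ N` satisfies `N ∤ q² - 1`, and `P'` a `ℚ_v`-point of order `N` of the minimal model
`E.localMinimalModel v`.  Then `P' ∉ E₀(ℚ_v)`.  (Same argument as the tree's
`Mazur1977_not_mem_goodReductionSubgroup_of_addOrderOf_eq`, which assumed `q + 1 < N`: the
reduction is multiplicative by Step 1 (`eq_zero_of_hasAdditiveReduction_of_prime_nsmul_eq_zero`);
on `E₀(ℚ_v)` a point of order `N` forces `N ≤ 2q + 1` (`addOrderOf_le_of_mem_goodReductionSubgroup`)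
and, for `q ≥ 5`, `N ∣ #Ẽ_ns(𝔽_q) ∣ q² - 1` (`prime_dvd_card_sq_sub_one_of_mem_goodReductionSubgroup`,
"`(E_{/𝔽_q})⁰ ≅ 𝔾_m` possesses `q² - 1` points …", Mazur p. 159).)  Thus Mazur's global Step 3
(Eisenstein quotient) is needed exactly at the bad primes `q ≡ ±1 (mod N)`.
[cite: Mazur1977, Ch. III §5, Steps 1–3, pp. 158–160] -/
theorem Mazur1977_not_mem_goodReductionSubgroup_of_not_dvd {N : ℕ} (hN : N.Prime)
    (hNS : N ∉ ({2, 3, 5, 7, 13} : Finset ℕ)) (v : HeightOneSpectrum (𝓞 ℚ))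
    (hvN : (primesEquiv v : ℕ) ≠ N) (hq : ¬ N ∣ (primesEquiv v : ℕ) ^ 2 - 1)
    (hbad : ¬ W.HasGoodReductionAt v)
    {P' : (W.localMinimalModel v).toAffine.Point} (hP'ord : addOrderOf P' = N) :
    P' ∉ (W.localMinimalModel v).goodReductionSubgroup (v.adicCompletionIntegers ℚ) := by
  have h11 := eleven_le_of_prime_of_not_mem hN hNS
  have hqprime : (primesEquiv v : ℕ).Prime := (primesEquiv v).2
  haveI : (W.localMinimalModel v).IsElliptic := W.isElliptic_localMinimalModel v
  have hcard : Nat.card (IsLocalRing.ResidueField (v.adicCompletionIntegers ℚ)) = (primesEquiv v : ℕ) :=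
    WeierstrassCurve.natCard_residueField_adicCompletionIntegers v
  haveI : Finite (IsLocalRing.ResidueField (v.adicCompletionIntegers ℚ)) :=
    Nat.finite_of_card_ne_zero (by rw [hcard]; exact hqprime.ne_zero)
  haveI : PerfectField (IsLocalRing.ResidueField (v.adicCompletionIntegers ℚ)) := PerfectField.ofFinite
  have hP'0 : P' ≠ 0 := by
    intro h0
    rw [h0, addOrderOf_zero] at hP'ord
    exact absurd hP'ord.symm (by omega)
  have hkill' : N • P' = 0 := by
    have e := addOrderOf_nsmul_eq_zero P'
    rwa [hP'ord] at e
  have hkill : (N : ℤ) • P' = 0 := by rw [natCast_zsmul]; exact hkill'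
  have hNk : (N : IsLocalRing.ResidueField (v.adicCompletionIntegers ℚ)) ≠ 0 :=
    natCast_residueField_adicCompletionIntegers_ne_zero v hN hvN
  -- the reduction is multiplicative (not good by hypothesis, not additive by Step 1)
  have hmult : (W.localMinimalModel v).HasMultiplicativeReduction (v.adicCompletionIntegers ℚ) := by
    rcases hasGoodReduction_or_hasMultiplicativeReduction_or_hasAdditiveReduction
        (v.adicCompletionIntegers ℚ) (W := W.localMinimalModel v) with hg | hm | ha
    · exact absurd hg hbad
    · exact hm
    · exfalso
      haveI := ha
      exact hP'0 (eq_zero_of_hasAdditiveReduction_of_prime_nsmul_eq_zero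
        (v.adicCompletionIntegers ℚ) (W.localMinimalModel v) hN (by omega) hNk hkill')
  haveI := hmult
  intro hmem
  by_cases h2q : 2 * (primesEquiv v : ℕ) + 1 < N
  · have hle := addOrderOf_le_of_mem_goodReductionSubgroup (v.adicCompletionIntegers ℚ)
      (W.localMinimalModel v) hmem (n := N) (by exact_mod_cast hNk) hkill
    rw [hcard, hP'ord] at hle
    omega
  · have hchar : ringChar (IsLocalRing.ResidueField (v.adicCompletionIntegers ℚ)) = (primesEquiv v : ℕ) := by
      haveI := Fintype.ofFinite (IsLocalRing.ResidueField (v.adicCompletionIntegers ℚ))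
      obtain ⟨n, hp, hn⟩ := FiniteField.card (IsLocalRing.ResidueField (v.adicCompletionIntegers ℚ))
        (ringChar (IsLocalRing.ResidueField (v.adicCompletionIntegers ℚ)))
      rw [← Nat.card_eq_fintype_card, hcard] at hn
      exact (Nat.prime_dvd_prime_iff_eq hp hqprime).mp (hn ▸ dvd_pow_self _ n.ne_zero)
    have h2 : ringChar (IsLocalRing.ResidueField (v.adicCompletionIntegers ℚ)) ≠ 2 := by
      rw [hchar]; omega
    have h3 : ringChar (IsLocalRing.ResidueField (v.adicCompletionIntegers ℚ)) ≠ 3 := by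
      rw [hchar]; omega
    have hdvd := prime_dvd_card_sq_sub_one_of_mem_goodReductionSubgroup
      (v.adicCompletionIntegers ℚ) h2 h3 hN hNk (W.localMinimalModel v) hP'0 hkill hmem
    rw [hcard] at hdvd
    exact hq hdvd

/-- **Mazur's theorem (prime case), unconditionally, for the curves with no bad prime
`q ≡ ±1 (mod N)`.**  For a prime `N ∉ {2, 3, 5, 7, 13}` and an elliptic curve `W/ℚ` every bad
prime `q` of which has `q = N` or `N ∤ q² - 1`, no point of `W(ℚ)` has order `N`: Mazur's proof
with Step 3 supplied by `Mazur1977_not_mem_goodReductionSubgroup_of_not_dvd`, Step 4 by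
`Mazur1977_stepFour_of_stepThree`, the Third reduction by
`forall_smul_geomTorsion_eq_of_herbrand_of_inertia` with (R3) = `Mazur1977_herbrand`, and the
Second reduction `Mazur1977_secondReduction_of_forall_smul_eq` (the bad primes of the curves
isogenous to `W` are those of `W`). [cite: Mazur1977, Ch. III §5, pp. 156–160] -/
theorem Mazur1977_not_exists_addOrderOf_eq_of_not_dvd {N : ℕ} [Fact N.Prime]
    (hNS : N ∉ ({2, 3, 5, 7, 13} : Finset ℕ))
    (hbad : ∀ v : HeightOneSpectrum (𝓞 ℚ), ¬ W.HasGoodReductionAt v →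
      (primesEquiv v : ℕ) = N ∨ ¬ N ∣ (primesEquiv v : ℕ) ^ 2 - 1) :
    ¬ ∃ P : W.toAffine.Point, addOrderOf P = N := by
  rintro ⟨P, hP⟩
  have hN : N.Prime := Fact.out
  refine Mazur1977_secondReduction_of_forall_smul_eq W hP fun E _ hiso Q hQ0 hQ τ hτ S ↦ ?_
  obtain ⟨PE, hPE, -⟩ := exists_addOrderOf_eq_of_smul_eq E hQ0 hQ
  -- the bad places of `ℰ` are those of `E`
  have hbadE : ∀ v : HeightOneSpectrum (𝓞 ℚ), ¬ E.HasGoodReductionAt v →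
      (primesEquiv v : ℕ) = N ∨ ¬ N ∣ (primesEquiv v : ℕ) ^ 2 - 1 := fun v hv ↦
    hbad v (fun h ↦ hv ((hiso.hasGoodReductionAt_iff_of_isIsogenous v).mp h))
  -- Step 3 for `ℰ` at the bad `v ∤ N`
  have h3 : ∀ v : HeightOneSpectrum (𝓞 ℚ), ¬ E.HasGoodReductionAt v → (primesEquiv v : ℕ) ≠ N →
      VariableChange.pointEquiv (E.baseChange (v.adicCompletion ℚ))
          ((E.baseChange (v.adicCompletion ℚ)).exists_isMinimal (v.adicCompletionIntegers ℚ)).choose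
          (Affine.Point.map (W' := E.toAffine) (S := ℚ) (Algebra.ofId ℚ (v.adicCompletion ℚ)) PE) ∉
        (E.localMinimalModel v).goodReductionSubgroup (v.adicCompletionIntegers ℚ) := by
    intro v hv hvN
    exact Mazur1977_not_mem_goodReductionSubgroup_of_not_dvd E hN hNS v hvN
      ((hbadE v hv).resolve_left hvN) hv ((addOrderOf_pointEquiv_map_eq E v PE).trans hPE)
  -- Step 4 and the Third reduction
  have hunr : ∀ (v : HeightOneSpectrum (𝓞 ℚ)) (𝔓 : Ideal (absIntegers (𝓞 ℚ) ℚ)),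
      𝔓 ∈ v.primesAbove → ∀ τ' ∈ 𝔓.inertia (absoluteGaloisGroup ℚ),
        (∀ ζ : AlgebraicClosure ℚ, ζ ^ N = 1 → τ' • ζ = ζ) → ∀ S' : geomTorsion E N, τ' • S' = S' := by
    intro v 𝔓 h𝔓 τ' hτ'I hζ S'
    have hS' : N • (S' : geomPoints E) = 0 := by
      have h := (Submodule.mem_torsionBy_iff (N : ℤ) S'.1).mp S'.2
      rwa [natCast_zsmul] at h
    exact Subtype.ext (by
      rw [AddSubgroup.torsionBy.coe_smul]
      exact Mazur1977_stepFour_of_stepThree E hNS hPE h3 v h𝔓 hτ'I hζ hS')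
  exact forall_smul_geomTorsion_eq_of_herbrand_of_inertia E hPE
    (Mazur1977_herbrand (List.ne_of_not_mem_cons hNS)) hunr τ hτ S

omit [W.IsElliptic] in
/-- **Mazur's theorem, prime case, for every elliptic curve over `ℚ` with good reduction outside
the primes `≤ 17`** (e.g. every curve of conductor dividing a power of `2·3·5·7·11·13·17`): for
such `W` and every prime `N ∉ {2, 3, 5, 7, 13}`, `W(ℚ)` has no point of order `N`.  For `N = 11`
this is the tree's `Mazur1977_no_eleven_torsion` (Billing–Mahler, via
`Mazur1977_no_prime_torsion_of_forall_seventeen_le`); for `N ≥ 17` every bad prime `q ≤ 17` has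
`q + 1 < N` or `q = N = 17`, and `Mazur1977_not_exists_addOrderOf_eq` applies.
[cite: Mazur1977, Ch. III §5, Thm. (5.1) and pp. 156–160] -/
theorem Mazur1977_no_prime_torsion_of_bad_primes_le_seventeen
    (hbad : ∀ v : HeightOneSpectrum (𝓞 ℚ), ¬ W.HasGoodReductionAt v → (primesEquiv v : ℕ) ≤ 17) :
    Mazur1977_no_prime_torsion W := by
  refine Mazur1977_no_prime_torsion_of_forall_seventeen_le W fun p hp h17 => ?_
  haveI : Fact p.Prime := ⟨hp⟩
  have hpS : p ∉ ({2, 3, 5, 7, 13} : Finset ℕ) := by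
    simp only [Finset.mem_insert, Finset.mem_singleton]
    omega
  refine Mazur1977_not_exists_addOrderOf_eq W hpS fun v hv => ?_
  have hle := hbad v hv
  by_cases h : (primesEquiv v : ℕ) = p
  · exact Or.inr h
  · left
    have hq : (primesEquiv v : ℕ).Prime := (primesEquiv v).2
    -- `q ≤ 17`, `q ≠ p`, `17 ≤ p`: either `q + 1 < p`, or `q = 17 = p - 1` / `q = 16`, impossible
    rcases Nat.lt_or_ge ((primesEquiv v : ℕ) + 1) p with h1 | h1
    · exact h1
    · exfalso
      have hq17 : (primesEquiv v : ℕ) = 17 ∨ (primesEquiv v : ℕ) = 16 := by omega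
      rcases hq17 with h17' | h16
      · have hp18 : p = 18 ∨ p = 17 := by omega
        rcases hp18 with rfl | rfl
        · exact absurd hp (by norm_num)
        · exact h h17'
      · rw [h16] at hq
        exact absurd hq (by norm_num)

end Leaf

end Literature.NumberTheory.EllipticCurves

end
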